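import Summits.CriticalPhenomena.Ising3DConformalLimit.Theses.FKParityRobustness
import Literature.Probability.LatticeModels.RandomClusterFKG
import Literature.Probability.Percolation.PercolationEvents

/-!
# `FKFourConnectivity` — negative-side lemmas, I: the FK Lebowitz sandwich and the junk regime

Split of the standing disprover's work file
`Summits/CriticalPhenomena/Ising3DConformalLimit/Cruxes/FKFourConnectivity/Disproof.lean`
(crux `stmt-CriticalPhenomena-11254`, route `FKParityRobustness`). Nothing here asserts the crux.

* `pairProducts_sub_even_le_two_mul_allJoined`: on every finite graph, for `0 ≤ p ≤ 1`, `q ≥ 1` and any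
  wired set, `Σ_π φ(a_i↔a_j)φ(a_k↔a_l) − φ(EVEN) ≤ 2·φ(ALL)` where `EVEN` = "every open cluster holds an even
  number of the four marked vertices" and `ALL` = "all four joined". It is FKG (`rcMeasure_fkg_holds`,
  Fortuin–Kasteleyn–Ginibre 1971 / Grimmett 2006 Thm 3.8) plus the pointwise count
  `1[E₁]+1[E₂]+1[E₃] ≤ 1[E₁∪E₂∪E₃] + 2·1[ALL]`. Through Edwards–Sokal the left side is `−U₄ = |U₄|`
  (Aizenman 1982, Prop. 5.2 / Lebowitz 1974), so this is the lattice inequality `|U₄| ≤ 2P₄` that makes the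
  crux NECESSARY for every bound `|U₄(A_l)| ≥ c·G²` (the route's kill criterion, now a theorem on the FK side).
* `not_FKFourConnectivity_imp_pointwise_fk_triviality`: hence if the crux FAILS, then for every `c > 0`
  there are tetrahedra `A_l`, in arbitrarily large free boxes at `β_c(3)`, with
  `Σ_π φφ − φ(EVEN) < 2c·φ(a₀↔a₁)φ(a₂↔a₃)`: pointwise FK-triviality along tetrahedra. A disproof of the
  crux is a triviality theorem for critical 3D Ising at tetrahedral configurations.
* `rcMeasure_zero_eq_dirac`, `fkFourConnectivity_analogue_beta_zero`: at edge density `0` the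
  random-cluster measure is `δ_∅` and the crux's inequality degenerates to `0 ≤ 0`; the `β = 0` analogue of
  the crux holds for the wrong reason, so the statement's content rests on `criticalBeta_pos_holds` and no
  refutation comes from the degenerate end. `openConn_self`, `allJoined_const`: dropping `1 ≤ l` only
  forces `c ≤ 1`.

## References

* C. M. Fortuin, P. W. Kasteleyn, J. Ginibre, Comm. Math. Phys. 22 (1971) 89–103 [FortuinKasteleynGinibre1971].
* G. Grimmett, *The Random-Cluster Model*, Springer 2006, Thm 1.10, Thm 3.8 [Grimmett2006].
* M. Aizenman, Comm. Math. Phys. 86 (1982) 1–48, Prop. 5.2–5.3 (`|U₄| ≤ 2⟨σσ⟩⟨σσ⟩`, sign of `U₄`) [AizenmanCMP1982].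
* R. G. Edwards, A. D. Sokal, Phys. Rev. D 38 (1988) 2009 [EdwardsSokal1988].
-/

namespace Summit.CriticalPhenomena.Ising3DConformalLimit.Theorems.FKFourConnectivity.Negative

open MeasureTheory Finset
open Literature.Probability.LatticeModels Literature.Probability.Percolation

noncomputable section

/-! ## 1. The FK-side Lebowitz sandwich on an arbitrary finite graph -/

section Sandwich

variable {V : Type*}

/-- A hub vertex joined to all four marked vertices joins them all. [folklore] -/
theorem allJoined_of_hub {a : Fin 4 → V} {ω : BondConfig V}
    (h : ∀ i, (openGraph ω).Reachable (a 0) (a i)) : ω ∈ {ω | ∀ i j, (openGraph ω).Reachable (a i) (a j)} := by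
  intro i j
  exact (h i).symm.trans (h j)

/-- Two different pairing events force all four points into one cluster (pairings 01|23 and 02|13). [folklore] -/
theorem allJoined_of_pair01_pair02 {a : Fin 4 → V} {ω : BondConfig V}
    (h1 : ω ∈ (openConn (a 0) (a 1) ∩ openConn (a 2) (a 3))) (h2 : ω ∈ (openConn (a 0) (a 2) ∩ openConn (a 1) (a 3))) : ω ∈ {ω | ∀ i j, (openGraph ω).Reachable (a i) (a j)} := by
  obtain ⟨h01, h23⟩ := h1
  obtain ⟨h02, _⟩ := h2
  refine allJoined_of_hub fun i => ?_
  fin_cases i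
  · exact SimpleGraph.Reachable.refl _
  · exact h01
  · exact h02
  · exact h02.trans h23

/-- Two different pairing events force all four points into one cluster (pairings 01|23 and 03|12). [folklore] -/
theorem allJoined_of_pair01_pair03 {a : Fin 4 → V} {ω : BondConfig V}
    (h1 : ω ∈ (openConn (a 0) (a 1) ∩ openConn (a 2) (a 3))) (h3 : ω ∈ (openConn (a 0) (a 3) ∩ openConn (a 1) (a 2))) : ω ∈ {ω | ∀ i j, (openGraph ω).Reachable (a i) (a j)} := by
  obtain ⟨h01, h23⟩ := h1
  obtain ⟨h03, _⟩ := h3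
  refine allJoined_of_hub fun i => ?_
  fin_cases i
  · exact SimpleGraph.Reachable.refl _
  · exact h01
  · exact h03.trans h23.symm
  · exact h03

/-- Two different pairing events force all four points into one cluster (pairings 02|13 and 03|12). [folklore] -/
theorem allJoined_of_pair02_pair03 {a : Fin 4 → V} {ω : BondConfig V}
    (h2 : ω ∈ (openConn (a 0) (a 2) ∩ openConn (a 1) (a 3))) (h3 : ω ∈ (openConn (a 0) (a 3) ∩ openConn (a 1) (a 2))) : ω ∈ {ω | ∀ i j, (openGraph ω).Reachable (a i) (a j)} := by
  obtain ⟨h02, _⟩ := h2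
  obtain ⟨h03, h12⟩ := h3
  refine allJoined_of_hub fun i => ?_
  fin_cases i
  · exact SimpleGraph.Reachable.refl _
  · exact h02.trans h12.symm
  · exact h02
  · exact h03

/-- `ALL` is contained in every pairing event. [folklore] -/
theorem pairJoined_of_allJoined {a : Fin 4 → V} {ω : BondConfig V} (h : ω ∈ {ω | ∀ i j, (openGraph ω).Reachable (a i) (a j)})
    (i j k l : Fin 4) : ω ∈ (openConn (a i) (a j) ∩ openConn (a k) (a l)) :=
  ⟨h i j, h k l⟩

/-- Membership in `EVEN` is the disjunction of the three pairing events. [folklore] -/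
theorem evenJoined_iff {a : Fin 4 → V} {ω : BondConfig V} :
    ω ∈ (((openConn (a 0) (a 1) ∩ openConn (a 2) (a 3)) ∪ (openConn (a 0) (a 2) ∩ openConn (a 1) (a 3))) ∪ (openConn (a 0) (a 3) ∩ openConn (a 1) (a 2))) ↔ ω ∈ (openConn (a 0) (a 1) ∩ openConn (a 2) (a 3)) ∨ ω ∈ (openConn (a 0) (a 2) ∩ openConn (a 1) (a 3)) ∨ ω ∈ (openConn (a 0) (a 3) ∩ openConn (a 1) (a 2)) := by
  simp only [Set.mem_union, or_assoc]

/-- The elementary real-number inequality behind the pointwise count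
`1[E₁] + 1[E₂] + 1[E₃] ≤ 1[E₁ ∪ E₂ ∪ E₃] + 2·1[ALL]` (any two pairing events force `ALL`). [folklore] -/
theorem ite_count_le (c : ℝ) (hc : 0 ≤ c) (P1 P2 P3 PA PE : Prop) [Decidable P1] [Decidable P2]
    [Decidable P3] [Decidable PA] [Decidable PE]
    (h12 : P1 → P2 → PA) (h13 : P1 → P3 → PA) (h23 : P2 → P3 → PA)
    (hA1 : PA → P1) (hA2 : PA → P2) (hA3 : PA → P3) (hE : P1 ∨ P2 ∨ P3 → PE) :
    (if P1 then c else 0) + (if P2 then c else 0) + (if P3 then c else 0) ≤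
      (if PE then c else 0) + 2 * (if PA then c else 0) := by
  by_cases hA : PA
  · have h1 := hA1 hA; have h2 := hA2 hA; have h3 := hA3 hA
    have he := hE (Or.inl h1)
    simp only [h1, h2, h3, he, hA, if_true]
    linarith
  · by_cases h1 : P1 <;> by_cases h2 : P2 <;> by_cases h3 : P3
    · exact absurd (h12 h1 h2) hA
    · exact absurd (h12 h1 h2) hA
    · exact absurd (h13 h1 h3) hA
    · have he := hE (Or.inl h1)
      simp only [h1, h2, h3, he, hA, if_true, if_false]; linarith
    · exact absurd (h23 h2 h3) hA
    · have he := hE (Or.inr (Or.inl h2))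
      simp only [h1, h2, h3, he, hA, if_true, if_false]; linarith
    · have he := hE (Or.inr (Or.inr h3))
      simp only [h1, h2, h3, he, hA, if_true, if_false]; linarith
    · simp only [h1, h2, h3, hA, if_false]
      split_ifs <;> linarith

variable [Fintype V] [DecidableEq V] (G : SimpleGraph V) [DecidableRel G.Adj]

/-- **Pointwise-count inequality, integrated**: for any random-cluster measure `φ = φ^B_{G,p,q}`
(`0 ≤ p ≤ 1`, `0 < q`) and any four vertices,
`φ(E₀₁,₂₃) + φ(E₀₂,₁₃) + φ(E₀₃,₁₂) ≤ φ(EVEN) + 2 φ(ALL)` (in fact an equality, inclusion–exclusion). [folklore] -/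
theorem sum_pairJoined_le {p q : ℝ} (hp : p ∈ Set.Icc (0 : ℝ) 1) (hq : 0 < q) (B : Set V)
    (a : Fin 4 → V) :
    (rcMeasure G p q B).real (openConn (a 0) (a 1) ∩ openConn (a 2) (a 3)) + (rcMeasure G p q B).real (openConn (a 0) (a 2) ∩ openConn (a 1) (a 3))
        + (rcMeasure G p q B).real (openConn (a 0) (a 3) ∩ openConn (a 1) (a 2)) ≤
      (rcMeasure G p q B).real (((openConn (a 0) (a 1) ∩ openConn (a 2) (a 3)) ∪ (openConn (a 0) (a 2) ∩ openConn (a 1) (a 3))) ∪ (openConn (a 0) (a 3) ∩ openConn (a 1) (a 2))) + 2 * (rcMeasure G p q B).real {ω | ∀ i j, (openGraph ω).Reachable (a i) (a j)} := by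
  classical
  simp only [rcMeasure_real_apply G hp hq]
  rw [Finset.mul_sum, ← Finset.sum_add_distrib, ← Finset.sum_add_distrib, ← Finset.sum_add_distrib]
  refine Finset.sum_le_sum fun ω _ => ?_
  have hc : 0 ≤ rcWeight G p q B ω / rcPartitionFunction G p q B :=
    div_nonneg (rcWeight_nonneg G hp hq.le B ω) (rcPartitionFunction_pos G hp hq B).le
  exact ite_count_le _ hc _ _ _ _ _
    (fun h1 h2 => allJoined_of_pair01_pair02 h1 h2)
    (fun h1 h3 => allJoined_of_pair01_pair03 h1 h3)
    (fun h2 h3 => allJoined_of_pair02_pair03 h2 h3)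
    (fun h => pairJoined_of_allJoined h 0 1 2 3)
    (fun h => pairJoined_of_allJoined h 0 2 1 3)
    (fun h => pairJoined_of_allJoined h 0 3 1 2)
    (fun h => evenJoined_iff.2 h)

/-- **FK-side Lebowitz sandwich** (necessity of the crux): for `0 ≤ p ≤ 1`, `q ≥ 1`,
`Σ_π φ(a_i↔a_j) φ(a_k↔a_l) − φ(EVEN) ≤ 2 φ(ALL)`.
With Edwards–Sokal (`φ(x↔y) = ⟨σ_xσ_y⟩`, `φ(EVEN) = ⟨σ_A⟩`) the left side is `−U₄(a)`, so this is
`|U₄| ≤ 2 P₄`: any lower bound `|U₄(A_l)| ≥ c G²` forces the crux `P₄ ≥ (c/2) G²`. Uses only FKG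
(`rcMeasure_fkg_holds`, in tree) and the pointwise count. [folklore] -/
theorem pairProducts_sub_even_le_two_mul_allJoined {p q : ℝ} (hp : p ∈ Set.Icc (0 : ℝ) 1)
    (hq : 1 ≤ q) (B : Set V) (a : Fin 4 → V) :
    (rcMeasure G p q B).real (openConn (a 0) (a 1)) * (rcMeasure G p q B).real (openConn (a 2) (a 3))
      + (rcMeasure G p q B).real (openConn (a 0) (a 2)) * (rcMeasure G p q B).real (openConn (a 1) (a 3))
      + (rcMeasure G p q B).real (openConn (a 0) (a 3)) * (rcMeasure G p q B).real (openConn (a 1) (a 2))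
      - (rcMeasure G p q B).real (((openConn (a 0) (a 1) ∩ openConn (a 2) (a 3)) ∪ (openConn (a 0) (a 2) ∩ openConn (a 1) (a 3))) ∪ (openConn (a 0) (a 3) ∩ openConn (a 1) (a 2))) ≤
      2 * (rcMeasure G p q B).real {ω | ∀ i j, (openGraph ω).Reachable (a i) (a j)} := by
  have hq0 : 0 < q := one_pos.trans_le hq
  have f1 := rcMeasure_fkg_holds G hp hq B (isUpperSet_openConn (a 0) (a 1)) (isUpperSet_openConn (a 2) (a 3))
  have f2 := rcMeasure_fkg_holds G hp hq B (isUpperSet_openConn (a 0) (a 2)) (isUpperSet_openConn (a 1) (a 3))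
  have f3 := rcMeasure_fkg_holds G hp hq B (isUpperSet_openConn (a 0) (a 3)) (isUpperSet_openConn (a 1) (a 2))
  have hs := sum_pairJoined_le G hp hq0 B a
  linarith

/-- In particular `φ(a₀↔a₁) φ(a₂↔a₃) − φ(EVEN) ≤ 2 φ(ALL)` is NOT available: only the sum over the three
pairings is controlled; but the single-pairing FKG bound `φ(a₀↔a₁) φ(a₂↔a₃) ≤ φ(E₀₁,₂₃)` is. [folklore] -/
theorem pairProduct_le_pairJoined {p q : ℝ} (hp : p ∈ Set.Icc (0 : ℝ) 1) (hq : 1 ≤ q) (B : Set V)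
    (a : Fin 4 → V) :
    (rcMeasure G p q B).real (openConn (a 0) (a 1)) * (rcMeasure G p q B).real (openConn (a 2) (a 3)) ≤
      (rcMeasure G p q B).real (openConn (a 0) (a 1) ∩ openConn (a 2) (a 3)) :=
  rcMeasure_fkg_holds G hp hq B (isUpperSet_openConn (a 0) (a 1)) (isUpperSet_openConn (a 2) (a 3))


/-- From a two-sided bound to the crux inequality, on one graph (pure algebra given the sandwich):
if `2c·φ(a₀↔a₁)φ(a₂↔a₃) ≤ Σ_π φφ − φ(EVEN)` then `c·φ(a₀↔a₁)·φ(a₂↔a₃) ≤ φ(ALL)`. [folklore] -/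
theorem crux_pointwise_of_U4bound {p q : ℝ} (hp : p ∈ Set.Icc (0 : ℝ) 1) (hq : 1 ≤ q) (B : Set V)
    (a : Fin 4 → V) (c : ℝ)
    (h : 2 * c * ((rcMeasure G p q B).real (openConn (a 0) (a 1)) * (rcMeasure G p q B).real (openConn (a 2) (a 3))) ≤
      (rcMeasure G p q B).real (openConn (a 0) (a 1)) * (rcMeasure G p q B).real (openConn (a 2) (a 3))
      + (rcMeasure G p q B).real (openConn (a 0) (a 2)) * (rcMeasure G p q B).real (openConn (a 1) (a 3))
      + (rcMeasure G p q B).real (openConn (a 0) (a 3)) * (rcMeasure G p q B).real (openConn (a 1) (a 2))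
      - (rcMeasure G p q B).real (((openConn (a 0) (a 1) ∩ openConn (a 2) (a 3)) ∪ (openConn (a 0) (a 2) ∩ openConn (a 1) (a 3))) ∪ (openConn (a 0) (a 3) ∩ openConn (a 1) (a 2)))) :
    c * (rcMeasure G p q B).real (openConn (a 0) (a 1)) * (rcMeasure G p q B).real (openConn (a 2) (a 3)) ≤
      (rcMeasure G p q B).real {ω | ∀ i j, (openGraph ω).Reachable (a i) (a j)} := by
  have hs := pairProducts_sub_even_le_two_mul_allJoined G hp hq B a
  nlinarith [hs, h]

/-! ### Degenerate regimes: `p = 0` (β = 0) and coincident points (l = 0) -/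

/-- The random-cluster weight at `p = 0` vanishes off the empty configuration. [folklore] -/
theorem rcWeight_zero_of_ne_empty (q : ℝ) (B : Set V) {ω : Finset (Sym2 V)} (hω : ω ≠ ∅) :
    rcWeight G 0 q B ω = 0 := by
  have : #ω ≠ 0 := by rwa [Ne, Finset.card_eq_zero]
  simp [rcWeight, zero_pow this]

/-- At `p = 0` the partition function is the weight of the empty configuration. [folklore] -/
theorem rcPartitionFunction_zero (q : ℝ) (B : Set V) :
    rcPartitionFunction G 0 q B = rcWeight G 0 q B ∅ := by
  unfold rcPartitionFunction
  rw [← Finset.add_sum_erase _ _ (Finset.empty_mem_powerset _), Finset.sum_eq_zero, add_zero]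
  intro ω hω
  exact rcWeight_zero_of_ne_empty G q B (Finset.ne_of_mem_erase hω)

/-- **Junk/degenerate regime `p = 0`**: the random-cluster measure at `p = 0` is the point mass at the
closed configuration (so every connection probability between distinct points is `0` and the crux
inequality reads `0 ≤ 0`). The crux lives at `p = fkIsingParam (criticalBeta 3) > 0`
(`criticalBeta_pos_holds`), so no refutation and no cheap proof comes from this end. [folklore] -/
theorem rcMeasure_zero_eq_dirac {q : ℝ} (hq : 0 < q) (B : Set V) :
    rcMeasure G 0 q B = Measure.dirac (∅ : BondConfig V) := by
  have hZ : rcPartitionFunction G 0 q B = rcWeight G 0 q B ∅ := rcPartitionFunction_zero G q B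
  have hw : rcWeight G 0 q B ∅ ≠ 0 := by
    simp [rcWeight, hq.ne']
  unfold rcMeasure
  rw [← Finset.add_sum_erase _ _ (Finset.empty_mem_powerset _), Finset.sum_eq_zero, add_zero, hZ,
    div_self hw, ENNReal.ofReal_one, one_smul, Finset.coe_empty]
  intro ω hω
  rw [rcWeight_zero_of_ne_empty G q B (Finset.ne_of_mem_erase hω), zero_div, ENNReal.ofReal_zero, zero_smul]

omit [Fintype V] [DecidableEq V] in
/-- Under the point mass at the closed configuration, distinct points are never joined. [folklore] -/
theorem dirac_empty_real_openConn [Countable V] {x y : V} (hxy : x ≠ y) :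
    (Measure.dirac (∅ : BondConfig V)).real (openConn x y) = 0 := by
  have hmem : (∅ : BondConfig V) ∉ openConn x y := by
    intro h
    simp only [openConn, Set.mem_setOf_eq, openGraph, SimpleGraph.fromEdgeSet_empty,
      SimpleGraph.reachable_bot] at h
    exact hxy h
  rw [measureReal_def, Measure.dirac_apply, Set.indicator_of_notMem hmem, ENNReal.toReal_zero]

/-- `fkIsingParam 0 = 0`: inverse temperature `0` is edge density `0`. [folklore] -/
theorem fkIsingParam_zero : fkIsingParam 0 = 0 := by simp [fkIsingParam]

omit [Fintype V] [DecidableEq V] in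
/-- Coincident points (`l = 0` in the crux, excluded by `1 ≤ l`): every event in sight is `univ`, so
dropping `1 ≤ l` only forces `c ≤ 1` — the hypothesis is cosmetic, not load-bearing. [folklore] -/
theorem openConn_self (x : V) : openConn x x = (Set.univ : Set (BondConfig V)) := by
  ext ω; simp [openConn]

omit [Fintype V] [DecidableEq V] in
/-- For coincident points `ALL = univ`. [folklore] -/
theorem allJoined_const (x : V) :
    {ω : BondConfig V | ∀ i j : Fin 4, (openGraph ω).Reachable ((fun _ : Fin 4 => x) i) ((fun _ : Fin 4 => x) j)} = Set.univ := by
  ext ω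
  simp only [Set.mem_setOf_eq, Set.mem_univ, iff_true]
  intro i j
  exact SimpleGraph.Reachable.refl _

end Sandwich

/-! ## 2. The crux itself: reformulations, the junk regime, and what a refutation would mean -/

section Crux

open scoped Classical

/-! Below, `![![-1, -1, -1], ![1, 1, -1], ![1, -1, 1], ![-1, 1, 1]]` is the crux's shape (alternate corners of
`{±1}³`, a regular tetrahedron of side `2√2`) and
`rcMeasure ((zdGraph 3).comap Subtype.val) (fkIsingParam β) 2 ∅` the free FK measure of the box graph on
`Λ_N = {−N..N}³` at edge density `fkIsingParam β`, `q = 2` (the crux takes `β = criticalBeta 3`); everything is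
written out (no auxiliary definitions) so that the statements match the crux syntactically. -/

/-- The four pinned sites are pairwise distinct as soon as `1 ≤ l` (coordinates `±l`). [folklore] -/
theorem pinned_ne {l : ℕ} (hl : 1 ≤ l) {N : ℕ} {a : Fin 4 → ↥(box 3 N)}
    (ha : ∀ i, ((a i : Site 3)) = (l : ℤ) • (![![-1, -1, -1], ![1, 1, -1], ![1, -1, 1], ![-1, 1, 1]] : Fin 4 → Site 3) i) {i j : Fin 4} (hij : i ≠ j) : a i ≠ a j := by
  intro h
  have h' : (l : ℤ) • (![![-1, -1, -1], ![1, 1, -1], ![1, -1, 1], ![-1, 1, 1]] : Fin 4 → Site 3) i = (l : ℤ) • (![![-1, -1, -1], ![1, 1, -1], ![1, -1, 1], ![-1, 1, 1]] : Fin 4 → Site 3) j := by rw [← ha i, ← ha j, h]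
  have hl0 : (l : ℤ) ≠ 0 := by exact_mod_cast Nat.one_le_iff_ne_zero.1 hl
  have key : (![![-1, -1, -1], ![1, 1, -1], ![1, -1, 1], ![-1, 1, 1]] : Fin 4 → Site 3) i = (![![-1, -1, -1], ![1, 1, -1], ![1, -1, 1], ![-1, 1, 1]] : Fin 4 → Site 3) j := by
    funext k
    have := congrFun h' k
    simp only [Pi.smul_apply, smul_eq_mul] at this
    exact mul_left_cancel₀ hl0 this
  fin_cases i <;> fin_cases j <;> first | exact hij rfl | (have := congrFun key 0; have := congrFun key 1; simp at *)

/-- **Junk regime is harmless but uninformative**: the crux's statement with `criticalBeta 3` replaced by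
`β = 0` (edge density `0`, `φ = δ_∅`) HOLDS, trivially (`c·0·0 ≤ 0`). So the statement would be "true for the
wrong reason" exactly if `criticalBeta 3 = 0`, which `criticalBeta_pos_holds` excludes: neither a refutation
nor a cheap proof of `FKFourConnectivity` can come from degenerate parameters. [folklore] -/
theorem fkFourConnectivity_analogue_beta_zero :
    ∃ c : ℝ, 0 < c ∧ ∀ l : ℕ, 1 ≤ l → ∃ N₀ : ℕ, ∀ N : ℕ, N₀ ≤ N → ∀ a : Fin 4 → ↥(box 3 N),
      (∀ i, ((a i : Site 3)) = (l : ℤ) • (![![-1, -1, -1], ![1, 1, -1], ![1, -1, 1], ![-1, 1, 1]] : Fin 4 → Site 3) i) →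
        c * (rcMeasure ((zdGraph 3).comap (Subtype.val : ↥(box 3 N) → Site 3)) (fkIsingParam 0) 2 ∅).real (openConn (a 0) (a 1)) * (rcMeasure ((zdGraph 3).comap (Subtype.val : ↥(box 3 N) → Site 3)) (fkIsingParam 0) 2 ∅).real (openConn (a 2) (a 3)) ≤
          (rcMeasure ((zdGraph 3).comap (Subtype.val : ↥(box 3 N) → Site 3)) (fkIsingParam 0) 2 ∅).real {ω | ∀ i j, (openGraph ω).Reachable (a i) (a j)} := by
  refine ⟨1, one_pos, fun l hl => ⟨0, fun N _ a ha => ?_⟩⟩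
  have h01 : a 0 ≠ a 1 := pinned_ne hl ha (by decide)
  have hμ : (rcMeasure ((zdGraph 3).comap (Subtype.val : ↥(box 3 N) → Site 3)) (fkIsingParam 0) 2 ∅) = Measure.dirac (∅ : BondConfig ↥(box 3 N)) := by
    rw [fkIsingParam_zero]
    exact rcMeasure_zero_eq_dirac ((zdGraph 3).comap (Subtype.val : ↥(box 3 N) → Site 3)) two_pos ∅
  rw [hμ, dirac_empty_real_openConn h01]
  simp only [mul_zero, zero_mul]
  exact measureReal_nonneg

/-- **What a refutation of the crux would mean** (the standing disprover's bottom line, kernel-checked):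
if `FKFourConnectivity` fails then for every `c > 0` there are tetrahedra `A_l` (some `l ≥ 1`), in
arbitrarily large free boxes, at which the FK-side Ursell combination
`Σ_π φ(a_i↔a_j)φ(a_k↔a_l) − φ(EVEN)` — equal to `−U₄(A_l) = |U₄(A_l)|` by Edwards–Sokal — is
`< 2c·φ(a₀↔a₁)φ(a₂↔a₃)`. I.e. `liminf_l |U₄(A_l)|/G(2√2 l)² = 0`: POINTWISE TRIVIALITY of the critical
3D Ising four-point function along tetrahedra, against the conjectured (bootstrap-measured) non-Gaussian
scaling limit. This is why the crux resists disproof: any counterexample is a triviality theorem for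
3D Ising. Conversely the crux is NECESSARY for the route (`|U₄| ≤ 2P₄`). [folklore] -/
theorem not_FKFourConnectivity_imp_pointwise_fk_triviality
    (hn : ¬ Summit.CriticalPhenomena.Ising3DConformalLimit.Theses.FKParityRobustness.FKFourConnectivity)
    (c : ℝ) (hc : 0 < c) :
    ∃ l : ℕ, 1 ≤ l ∧ ∀ N₀ : ℕ, ∃ N : ℕ, N₀ ≤ N ∧ ∃ a : Fin 4 → ↥(box 3 N),
      (∀ i, ((a i : Site 3)) = (l : ℤ) • (![![-1, -1, -1], ![1, 1, -1], ![1, -1, 1], ![-1, 1, 1]] : Fin 4 → Site 3) i) ∧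
      (rcMeasure ((zdGraph 3).comap (Subtype.val : ↥(box 3 N) → Site 3)) (fkIsingParam (criticalBeta 3)) 2 ∅).real (openConn (a 0) (a 1)) * (rcMeasure ((zdGraph 3).comap (Subtype.val : ↥(box 3 N) → Site 3)) (fkIsingParam (criticalBeta 3)) 2 ∅).real (openConn (a 2) (a 3))
        + (rcMeasure ((zdGraph 3).comap (Subtype.val : ↥(box 3 N) → Site 3)) (fkIsingParam (criticalBeta 3)) 2 ∅).real (openConn (a 0) (a 2)) * (rcMeasure ((zdGraph 3).comap (Subtype.val : ↥(box 3 N) → Site 3)) (fkIsingParam (criticalBeta 3)) 2 ∅).real (openConn (a 1) (a 3))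
        + (rcMeasure ((zdGraph 3).comap (Subtype.val : ↥(box 3 N) → Site 3)) (fkIsingParam (criticalBeta 3)) 2 ∅).real (openConn (a 0) (a 3)) * (rcMeasure ((zdGraph 3).comap (Subtype.val : ↥(box 3 N) → Site 3)) (fkIsingParam (criticalBeta 3)) 2 ∅).real (openConn (a 1) (a 2))
        - (rcMeasure ((zdGraph 3).comap (Subtype.val : ↥(box 3 N) → Site 3)) (fkIsingParam (criticalBeta 3)) 2 ∅).real (((openConn (a 0) (a 1) ∩ openConn (a 2) (a 3)) ∪ (openConn (a 0) (a 2) ∩ openConn (a 1) (a 3))) ∪ (openConn (a 0) (a 3) ∩ openConn (a 1) (a 2)))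
        < 2 * c * ((rcMeasure ((zdGraph 3).comap (Subtype.val : ↥(box 3 N) → Site 3)) (fkIsingParam (criticalBeta 3)) 2 ∅).real (openConn (a 0) (a 1)) *
            (rcMeasure ((zdGraph 3).comap (Subtype.val : ↥(box 3 N) → Site 3)) (fkIsingParam (criticalBeta 3)) 2 ∅).real (openConn (a 2) (a 3))) := by
  have hp : fkIsingParam (criticalBeta 3) ∈ Set.Icc (0 : ℝ) 1 :=
    fkIsingParam_mem_Icc (criticalBeta_nonneg 3)
  have hq : (1 : ℝ) ≤ 2 := by norm_num
  by_contra hcon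
  push Not at hcon
  apply hn
  refine ⟨c, hc, fun l hl => ?_⟩
  obtain ⟨N₀, hN₀⟩ := hcon l hl
  refine ⟨N₀, fun N hN a ha => ?_⟩
  exact crux_pointwise_of_U4bound ((zdGraph 3).comap (Subtype.val : ↥(box 3 N) → Site 3)) hp hq ∅ a c (hN₀ N hN a ha)

end Crux

end

end Summit.CriticalPhenomena.Ising3DConformalLimit.Theorems.FKFourConnectivity.Negative
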